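import Literature.Barriers.PneNP.MatchingSlackPsdRankSmall
import Literature.Combinatorics.Optimization.RationalPsdRank
import Literature.Combinatorics.Optimization.PsdFactorNorms
import Literature.Combinatorics.Optimization.SymmetricSDPMatching
import Literature.Combinatorics.AssociationSchemes.CutMatchingRestriction
import HarnessLib

/-!
# `rk_psd(S_odd(K₁₀)) ≥ 15`: one more than the fooling-set bound, by rank-one compression and parity

Companion to `MatchingSlackPsdRankEightLower.lean` (the `K₈` case, `10 ≤ rk_psd ≤ 14`) and to
`MatchingSlackPsdRankSmall.lean` (`14 ≤ rk_psd(S_odd(K₁₀))` by a triangular pattern of size `14`, which an exhaustive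
search shows to be the largest; the exact `S₁₀`-equivariant factorisation has size `Catalan(5) = 42`). For the
odd-cut slack matrix `S_{UM} = |δ(U) ∩ M| − 1` of the perfect matching polytope of `K₁₀` (`pmOddCutSlack 10`) we prove

  `¬ HasPsdFactorization (pmOddCutSlack 10) 14`, i.e. `rk_psd(S_odd(K₁₀)) ≥ 15`

(`not_hasPsdFactorization_pmOddCutSlack_ten_fourteen`, `fifteen_le_of_hasPsdFactorization_ten`), by the same
three steps as at `n = 8` [GouveiaRobinsonThomas2013, Prop. 2.6 + Lemma 2.4 (p05–p07), Ex. 2.3 (p05);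
FawziEtAl2015, Prop. 6.2 (p18)], now on the block of rows `|U| ∈ {3, 5}` (entries `0, 2, 4`):

1. (compression) every row of size `3`, every row of size `5` and every column has a triangular `13`-pattern
   inside its zero set (base patterns for `{0,1,2}`, `{0,1,2,3,4}` and `{01,23,45,67,89}` decided by the kernel,
   transported by `S₁₀`; exhaustively, `13` is also the maximum there), so every factor of a size-`14` psd
   factorisation has rank `≤ 1` (`rank_rowFactor/colFactor_add_le_of_triangular`);
2. (square roots) hence a real `N` with `N ∘ N = S` of rank `≤ 14` (`FawziEtAl2015_prop62_holds`);
3. (parity) every such `N` has rank `≥ 15`: on an explicit `15 × 15` minor inside the `3`-set rows (where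
   `S ∈ {0, 2}`) `N = √2·Z` with `Z` an integer sign matrix congruent modulo `2` to the `0/1` support `X`, and
   `X` is invertible over `𝔽₂` (explicit inverse; the `𝔽₂`-rank of the `3`-set block's support is `27`).

Honest limits: `+1` over the fooling bound only; whether the zero-set patterns of size `τ − 1` persist for all `n`
(they do for `n = 8, 10`) is not claimed; numerically the cell's engines bracket nothing below `42` at `n = 10` yet.
Label: instrument / small exact theorem about the route Target's object. WHAT THIS IS NOT: no statement about the
crux `TracialDecayExp20` (stmt-PneNP-19878), nothing asymptotic, no P-vs-NP content.
-/

noncomputable section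

open Finset Matrix Equiv

namespace Literature.Barriers.PneNP

open Literature.Combinatorics.Optimization
  (HasPsdFactorization HasHadamardSqrtOfRankLE FawziEtAl2015_prop62_holds rank_rowFactor_add_le_of_triangular
    rank_colFactor_add_le_of_triangular isPMOn_univ_image_map)
open Literature.Combinatorics.AssociationSchemes.CutMatchingRestriction (crossCount crossCount_image cc_eq_crossCount)
open Literature.Combinatorics.AssociationSchemes.MatchingLevelInequality
  (fpfInvolutions mem_fpfInvolutions exists_perm_fixing_image_eq exists_conj_eq)
open Literature.Combinatorics.AssociationSchemes.HomogeneousMatchingFamilies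
  (permOf edgesOf edgesOf_permOf permOf_mem_fpfInvolutions)

namespace PsdRankTenLower

/-! ### §1 The `{3,5}`-set block of `S_odd(K₁₀)` and vertex relabelling -/

/-- Row index type of the block: subsets of `Fin 10` of size `3` or `5`. [cite: Rothvoss2017, §2 (PDF p. 5)] -/
abbrev T35 : Type := {U : Finset (Fin 10) // U.card = 3 ∨ U.card = 5}

/-- A `3`- or `5`-set is an odd set. [cite: Rothvoss2017, §2 (PDF p. 5)] -/
def toOdd (U : T35) : OddSet 10 := ⟨U.1, by rcases U.2 with h | h <;> rw [h] <;> decide⟩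

/-- The block `S₃₅(U, M) = cc(U, M) − 1` of the odd-cut slack matrix of `K₁₀`. [cite: KaniewskiLeeDewolf2015, §7.3 (p. 12)] -/
def S35 (U : T35) (M : PMatch 10) : ℝ := pmOddCutSlack 10 (toOdd U) M

/-- Unfolding: `S₃₅(U, M) = cc(U, M) − 1`. [cite: KaniewskiLeeDewolf2015, §7.3 (p. 12)] -/
theorem S35_apply (U : T35) (M : PMatch 10) : S35 U M = (cc (toOdd U) M : ℝ) - 1 := rfl

/-- `S₃₅(U, M) = 0 ↔ cc(U, M) = 1`. [cite: FawziEtAl2015, §5.2 (p15)] -/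
theorem S35_eq_zero_iff (U : T35) (M : PMatch 10) : S35 U M = 0 ↔ cc (toOdd U) M = 1 := by
  rw [S35_apply, sub_eq_zero]
  exact_mod_cast Iff.rfl

/-- A psd factorisation of the full odd-cut slack matrix restricts to the block. [cite: FawziEtAl2015, Ex. 5.1 (p14)] -/
theorem hasPsdFactorization_S35 {r : ℕ} (h : HasPsdFactorization (pmOddCutSlack 10) r) : HasPsdFactorization S35 r :=
  h.submatrix toOdd id

/-- Relabelling a row by a vertex permutation. [cite: Rothvoss2017, §2 (PDF p. 5)] -/
def imgT (σ : Perm (Fin 10)) (U : T35) : T35 :=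
  ⟨U.1.image σ, by rw [card_image_of_injective _ σ.injective]; exact U.2⟩

/-- Relabelling a perfect matching by a vertex permutation. [cite: BraunEtAl2016, §4.5 (p. 9)] -/
def imgP (σ : Perm (Fin 10)) (M : PMatch 10) : PMatch 10 :=
  ⟨M.1.image (Sym2.map σ), isPMOn_univ_image_map σ M.2⟩

/-- Crossing numbers are invariant under simultaneous relabelling. [cite: Rothvoss2017, §2 (PDF p. 5)] -/
theorem cc_imgT_imgP (σ : Perm (Fin 10)) (U : T35) (M : PMatch 10) :
    cc (toOdd (imgT σ U)) (imgP σ M) = cc (toOdd U) M := by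
  rw [cc_eq_crossCount, cc_eq_crossCount]
  exact crossCount_image σ.injective U.1 M.1

/-- Hence the block entries are invariant under simultaneous relabelling. [cite: Rothvoss2017, §2 (PDF p. 5)] -/
theorem S35_imgT_imgP (σ : Perm (Fin 10)) (U : T35) (M : PMatch 10) : S35 (imgT σ U) (imgP σ M) = S35 U M := by
  rw [S35_apply, S35_apply, cc_imgT_imgP]

/-- The base `3`-row `U₀ = {0,1,2}`. [cite: Rothvoss2017, §2 (PDF p. 5)] -/
def U0 : T35 := ⟨{0, 1, 2}, by decide⟩

/-- The base `5`-row `U₀' = {0,1,2,3,4}`. [cite: Rothvoss2017, §2 (PDF p. 5)] -/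
def U0' : T35 := ⟨{0, 1, 2, 3, 4}, by decide⟩

/-- The base column `M₀ = {01, 23, 45, 67, 89}`. [cite: Rothvoss2017, §2 (PDF p. 6)] -/
def M0 : PMatch 10 := ⟨{s(0, 1), s(2, 3), s(4, 5), s(6, 7), s(8, 9)}, by decide⟩

/-- `S₁₀` is transitive on `3`-sets and on `5`-sets: every row is a relabelling of `U₀` or of `U₀'`.
[cite: KeevashLifshitz2023, §1.2 (p. 4)] -/
theorem exists_imgT_eq (U : T35) : (∃ σ : Perm (Fin 10), imgT σ U0 = U) ∨ ∃ σ : Perm (Fin 10), imgT σ U0' = U := by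
  rcases U.2 with h3 | h5
  · left
    obtain ⟨σ, -, hσ⟩ := exists_perm_fixing_image_eq (n := 10) ((U0.1 \ U.1).card) ∅ U0.1 U.1 rfl
      (by rw [h3]; rfl) (by simp)
    exact ⟨σ, Subtype.ext hσ⟩
  · right
    obtain ⟨σ, -, hσ⟩ := exists_perm_fixing_image_eq (n := 10) ((U0'.1 \ U.1).card) ∅ U0'.1 U.1 rfl
      (by rw [h5]; rfl) (by simp)
    exact ⟨σ, Subtype.ext hσ⟩

/-- Conjugating a fixed-point-free involution relabels its edge set. [cite: GodsilMeagher2015, §15.2] -/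
theorem edgesOf_conj (σ s : Perm (Fin 10)) : edgesOf (σ * s * σ⁻¹) = (edgesOf s).image (Sym2.map σ) := by
  ext e
  simp only [edgesOf, mem_image, mem_univ, true_and, Perm.mul_apply]
  constructor
  · rintro ⟨x, rfl⟩
    exact ⟨s(σ⁻¹ x, s (σ⁻¹ x)), ⟨σ⁻¹ x, rfl⟩, by simp⟩
  · rintro ⟨_, ⟨y, rfl⟩, rfl⟩
    exact ⟨σ y, by simp⟩

/-- `S₁₀` is transitive on perfect matchings: every column is a relabelling of `M₀`.
[cite: GodsilMeagher2015, §15.2 (the perfect matchings form one `S_n`-orbit)] -/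
theorem exists_imgP_eq (M : PMatch 10) : ∃ σ : Perm (Fin 10), imgP σ M0 = M := by
  obtain ⟨σ, hσ⟩ := exists_conj_eq (permOf_mem_fpfInvolutions M0.2) (permOf_mem_fpfInvolutions M.2)
  refine ⟨σ, Subtype.ext ?_⟩
  show M0.1.image (Sym2.map σ) = M.1
  rw [← edgesOf_permOf M.2, ← hσ, edgesOf_conj, edgesOf_permOf M0.2]

/-! ### §2 The three base patterns (kernel `decide`) -/

/-- Rows of the base pattern for the `3`-row `U₀`. [cite: GouveiaRobinsonThomas2013, Prop. 2.6 (p06)] -/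
def ρ0 : Fin 13 → T35 :=
  ![⟨{0, 1, 2, 3, 5}, by decide⟩, ⟨{6, 7, 9}, by decide⟩, ⟨{0, 3, 5}, by decide⟩, ⟨{4, 6, 8}, by decide⟩,
    ⟨{0, 3, 5, 7, 9}, by decide⟩, ⟨{1, 2, 8}, by decide⟩, ⟨{0, 1, 2, 4, 8}, by decide⟩, ⟨{3, 5, 7}, by decide⟩,
    ⟨{4, 6, 9}, by decide⟩, ⟨{2, 4, 8}, by decide⟩, ⟨{0, 3, 7}, by decide⟩, ⟨{0, 1, 3}, by decide⟩,
    ⟨{0, 1, 4}, by decide⟩]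

/-- Columns of the base pattern for `U₀` (all with `cc(U₀, ·) = 1`). [cite: GouveiaRobinsonThomas2013, Prop. 2.6 (p06)] -/
def γ0 : Fin 13 → PMatch 10 :=
  ![⟨{s(0, 9), s(1, 2), s(3, 8), s(4, 6), s(5, 7)}, by decide⟩, ⟨{s(0, 5), s(1, 2), s(3, 7), s(4, 9), s(6, 8)}, by decide⟩,
    ⟨{s(0, 2), s(1, 5), s(3, 4), s(6, 7), s(8, 9)}, by decide⟩, ⟨{s(0, 5), s(1, 2), s(3, 4), s(6, 9), s(7, 8)}, by decide⟩,
    ⟨{s(0, 1), s(2, 9), s(3, 5), s(4, 8), s(6, 7)}, by decide⟩, ⟨{s(0, 2), s(1, 4), s(3, 5), s(6, 8), s(7, 9)}, by decide⟩,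
    ⟨{s(0, 3), s(1, 2), s(4, 5), s(6, 8), s(7, 9)}, by decide⟩, ⟨{s(0, 3), s(1, 2), s(4, 8), s(5, 9), s(6, 7)}, by decide⟩,
    ⟨{s(0, 4), s(1, 2), s(3, 5), s(6, 8), s(7, 9)}, by decide⟩, ⟨{s(0, 2), s(1, 8), s(3, 5), s(4, 6), s(7, 9)}, by decide⟩,
    ⟨{s(0, 1), s(2, 8), s(3, 5), s(4, 6), s(7, 9)}, by decide⟩, ⟨{s(0, 5), s(1, 2), s(3, 7), s(4, 8), s(6, 9)}, by decide⟩,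
    ⟨{s(0, 3), s(1, 2), s(4, 8), s(5, 7), s(6, 9)}, by decide⟩]

/-- The base pattern of the `3`-row `U₀`: inside its zero columns, triangular of size `13`.
[cite: GouveiaRobinsonThomas2013, Prop. 2.6 (p06)] -/
theorem rowPattern3_base :
    (∀ a, cc (toOdd U0) (γ0 a) = 1) ∧ (∀ a, cc (toOdd (ρ0 a)) (γ0 a) ≠ 1) ∧
      ∀ a b : Fin 13, a < b → cc (toOdd (ρ0 a)) (γ0 b) = 1 := by
  refine ⟨by decide, by decide, by decide⟩

/-- Rows of the base pattern for the `5`-row `U₀'`. [cite: GouveiaRobinsonThomas2013, Prop. 2.6 (p06)] -/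
def ρ0' : Fin 13 → T35 :=
  ![⟨{1, 2, 3}, by decide⟩, ⟨{5, 6, 7}, by decide⟩, ⟨{0, 1, 4}, by decide⟩, ⟨{0, 1, 4, 8, 9}, by decide⟩,
    ⟨{2, 3, 7}, by decide⟩, ⟨{0, 2, 3}, by decide⟩, ⟨{0, 8, 9}, by decide⟩, ⟨{1, 4, 7}, by decide⟩,
    ⟨{1, 2, 4}, by decide⟩, ⟨{0, 5, 9}, by decide⟩, ⟨{0, 1, 9}, by decide⟩, ⟨{0, 5, 8}, by decide⟩,
    ⟨{0, 1, 2}, by decide⟩]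

/-- Columns of the base pattern for `U₀'` (all with `cc(U₀', ·) = 1`). [cite: GouveiaRobinsonThomas2013, Prop. 2.6 (p06)] -/
def γ0' : Fin 13 → PMatch 10 :=
  ![⟨{s(0, 3), s(1, 9), s(2, 4), s(5, 8), s(6, 7)}, by decide⟩, ⟨{s(0, 7), s(1, 4), s(2, 3), s(5, 9), s(6, 8)}, by decide⟩,
    ⟨{s(0, 9), s(1, 3), s(2, 4), s(5, 8), s(6, 7)}, by decide⟩, ⟨{s(0, 4), s(1, 3), s(2, 9), s(5, 8), s(6, 7)}, by decide⟩,
    ⟨{s(0, 4), s(1, 3), s(2, 6), s(5, 7), s(8, 9)}, by decide⟩, ⟨{s(0, 4), s(1, 3), s(2, 7), s(5, 6), s(8, 9)}, by decide⟩,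
    ⟨{s(0, 4), s(1, 9), s(2, 3), s(5, 8), s(6, 7)}, by decide⟩, ⟨{s(0, 4), s(1, 6), s(2, 3), s(5, 7), s(8, 9)}, by decide⟩,
    ⟨{s(0, 4), s(1, 7), s(2, 3), s(5, 6), s(8, 9)}, by decide⟩, ⟨{s(0, 8), s(1, 4), s(2, 3), s(5, 7), s(6, 9)}, by decide⟩,
    ⟨{s(0, 8), s(1, 4), s(2, 3), s(5, 9), s(6, 7)}, by decide⟩, ⟨{s(0, 9), s(1, 4), s(2, 3), s(5, 7), s(6, 8)}, by decide⟩,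
    ⟨{s(0, 9), s(1, 4), s(2, 3), s(5, 8), s(6, 7)}, by decide⟩]

/-- The base pattern of the `5`-row `U₀'`: inside its zero columns, triangular of size `13`.
[cite: GouveiaRobinsonThomas2013, Prop. 2.6 (p06)] -/
theorem rowPattern5_base :
    (∀ a, cc (toOdd U0') (γ0' a) = 1) ∧ (∀ a, cc (toOdd (ρ0' a)) (γ0' a) ≠ 1) ∧
      ∀ a b : Fin 13, a < b → cc (toOdd (ρ0' a)) (γ0' b) = 1 := by
  refine ⟨by decide, by decide, by decide⟩

/-- Rows of the base COLUMN pattern (all with `cc(·, M₀) = 1`). [cite: GouveiaRobinsonThomas2013, Prop. 2.6 (p06)] -/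
def ρ1 : Fin 13 → T35 :=
  ![⟨{0, 8, 9}, by decide⟩, ⟨{0, 4, 5, 8, 9}, by decide⟩, ⟨{4, 5, 8}, by decide⟩, ⟨{1, 6, 7}, by decide⟩,
    ⟨{0, 2, 3, 8, 9}, by decide⟩, ⟨{4, 5, 6}, by decide⟩, ⟨{0, 4, 5}, by decide⟩, ⟨{2, 3, 8}, by decide⟩,
    ⟨{2, 3, 6}, by decide⟩, ⟨{0, 2, 3}, by decide⟩, ⟨{0, 1, 9}, by decide⟩, ⟨{0, 1, 8}, by decide⟩,
    ⟨{0, 1, 2}, by decide⟩]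

/-- Columns of the base COLUMN pattern. [cite: GouveiaRobinsonThomas2013, Prop. 2.6 (p06)] -/
def γ1 : Fin 13 → PMatch 10 :=
  ![⟨{s(0, 7), s(1, 9), s(2, 8), s(3, 6), s(4, 5)}, by decide⟩, ⟨{s(0, 9), s(1, 8), s(2, 7), s(3, 5), s(4, 6)}, by decide⟩,
    ⟨{s(0, 8), s(1, 7), s(2, 6), s(3, 5), s(4, 9)}, by decide⟩, ⟨{s(0, 9), s(1, 8), s(2, 7), s(3, 6), s(4, 5)}, by decide⟩,
    ⟨{s(0, 9), s(1, 7), s(2, 6), s(3, 5), s(4, 8)}, by decide⟩, ⟨{s(0, 9), s(1, 6), s(2, 3), s(4, 8), s(5, 7)}, by decide⟩,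
    ⟨{s(0, 9), s(1, 7), s(2, 3), s(4, 8), s(5, 6)}, by decide⟩, ⟨{s(0, 8), s(1, 7), s(2, 9), s(3, 6), s(4, 5)}, by decide⟩,
    ⟨{s(0, 9), s(1, 6), s(2, 8), s(3, 7), s(4, 5)}, by decide⟩, ⟨{s(0, 9), s(1, 7), s(2, 8), s(3, 6), s(4, 5)}, by decide⟩,
    ⟨{s(0, 8), s(1, 7), s(2, 3), s(4, 5), s(6, 9)}, by decide⟩, ⟨{s(0, 9), s(1, 7), s(2, 3), s(4, 5), s(6, 8)}, by decide⟩,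
    ⟨{s(0, 9), s(1, 8), s(2, 3), s(4, 5), s(6, 7)}, by decide⟩]

/-- The base column pattern: inside the zero rows of `M₀`, triangular of size `13`.
[cite: GouveiaRobinsonThomas2013, Prop. 2.6 (p06)] -/
theorem colPattern_base :
    (∀ a, cc (toOdd (ρ1 a)) M0 = 1) ∧ (∀ a, cc (toOdd (ρ1 a)) (γ1 a) ≠ 1) ∧
      ∀ a b : Fin 13, a < b → cc (toOdd (ρ1 a)) (γ1 b) = 1 := by
  refine ⟨by decide, by decide, by decide⟩

/-! ### §3 Compression: every factor of a size-`14` factorisation of the block has rank `≤ 1` -/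

/-- **Rank-one factors.** In any psd factorisation of the block of SIZE `14`, every row factor and every column
factor has rank `≤ 1` (transported `13`-patterns, `rank + 13 ≤ 14`).
[cite: GouveiaRobinsonThomas2013, Prop. 2.6 (p06); Prop. 3.2 (p07)] -/
theorem factors_rank_le_one (A : T35 → Matrix (Fin 14) (Fin 14) ℝ) (B : PMatch 10 → Matrix (Fin 14) (Fin 14) ℝ)
    (hA : ∀ i, (A i).PosSemidef) (hB : ∀ j, (B j).PosSemidef) (hM : ∀ i j, S35 i j = (A i * B j).trace) :
    (∀ i, (A i).rank ≤ 1) ∧ ∀ j, (B j).rank ≤ 1 := by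
  obtain ⟨r0, r1, r2⟩ := rowPattern3_base
  obtain ⟨q0, q1, q2⟩ := rowPattern5_base
  obtain ⟨c0, c1, c2⟩ := colPattern_base
  refine ⟨fun U => ?_, fun M => ?_⟩
  · rcases exists_imgT_eq U with ⟨σ, rfl⟩ | ⟨σ, rfl⟩
    · have h := rank_rowFactor_add_le_of_triangular A B hA hB hM (imgT σ U0) (fun a => imgT σ (ρ0 a))
        (fun a => imgP σ (γ0 a))
        (fun a => by rw [S35_imgT_imgP, S35_eq_zero_iff]; exact r0 a)
        (fun a h => r1 a ((S35_eq_zero_iff _ _).1 (by rwa [S35_imgT_imgP] at h)))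
        (fun a b hab => by rw [S35_imgT_imgP, S35_eq_zero_iff]; exact r2 a b hab)
      omega
    · have h := rank_rowFactor_add_le_of_triangular A B hA hB hM (imgT σ U0') (fun a => imgT σ (ρ0' a))
        (fun a => imgP σ (γ0' a))
        (fun a => by rw [S35_imgT_imgP, S35_eq_zero_iff]; exact q0 a)
        (fun a h => q1 a ((S35_eq_zero_iff _ _).1 (by rwa [S35_imgT_imgP] at h)))
        (fun a b hab => by rw [S35_imgT_imgP, S35_eq_zero_iff]; exact q2 a b hab)
      omega
  · obtain ⟨σ, rfl⟩ := exists_imgP_eq M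
    have h := rank_colFactor_add_le_of_triangular A B hA hB hM (imgP σ M0) (fun a => imgT σ (ρ1 a))
      (fun a => imgP σ (γ1 a))
      (fun a => by rw [S35_imgT_imgP, S35_eq_zero_iff]; exact c0 a)
      (fun a h => c1 a ((S35_eq_zero_iff _ _).1 (by rwa [S35_imgT_imgP] at h)))
      (fun a b hab => by rw [S35_imgT_imgP, S35_eq_zero_iff]; exact c2 a b hab)
    omega

/-! ### §4 Rank-one factors give a Hadamard square root of rank `≤ 14` -/

/-- A size-`14` psd factorisation of the block would give a real `N` with `N ∘ N = S₃₅` and `rank N ≤ 14`.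
[cite: FawziEtAl2015, Prop. 6.2 (p18)] -/
theorem hasHadamardSqrt_of_hasPsdFactorization_fourteen (h : HasPsdFactorization S35 14) :
    HasHadamardSqrtOfRankLE S35 14 := by
  obtain ⟨A, B, hA, hB, hM⟩ := h
  obtain ⟨hAr, hBr⟩ := factors_rank_le_one A B hA hB hM
  exact FawziEtAl2015_prop62_holds T35 (PMatch 10) S35 14 ⟨A, B, fun i => ⟨hA i, hAr i⟩, fun j => ⟨hB j, hBr j⟩, hM⟩

/-! ### §5 Parity: every Hadamard square root of the block has rank `≥ 15` -/

/-- Rows of the `15 × 15` minor (all `3`-sets, so the entries there are `0` or `2`). [cite: GouveiaRobinsonThomas2013, Ex. 2.3 (p05)] -/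
def ρm : Fin 15 → T35 :=
  ![⟨{6, 7, 9}, by decide⟩, ⟨{3, 7, 9}, by decide⟩, ⟨{0, 2, 3}, by decide⟩, ⟨{0, 1, 4}, by decide⟩,
    ⟨{1, 2, 5}, by decide⟩, ⟨{3, 4, 9}, by decide⟩, ⟨{0, 2, 7}, by decide⟩, ⟨{1, 7, 9}, by decide⟩,
    ⟨{2, 5, 7}, by decide⟩, ⟨{0, 1, 2}, by decide⟩, ⟨{0, 1, 7}, by decide⟩, ⟨{0, 1, 3}, by decide⟩,
    ⟨{1, 6, 9}, by decide⟩, ⟨{3, 5, 6}, by decide⟩, ⟨{4, 8, 9}, by decide⟩]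

/-- Columns of the `15 × 15` minor. [cite: GouveiaRobinsonThomas2013, Ex. 2.3 (p05)] -/
def γm : Fin 15 → PMatch 10 :=
  ![⟨{s(0, 3), s(1, 9), s(2, 7), s(4, 6), s(5, 8)}, by decide⟩, ⟨{s(0, 8), s(1, 9), s(2, 4), s(3, 5), s(6, 7)}, by decide⟩,
    ⟨{s(0, 9), s(1, 2), s(3, 8), s(4, 7), s(5, 6)}, by decide⟩, ⟨{s(0, 9), s(1, 2), s(3, 7), s(4, 8), s(5, 6)}, by decide⟩,
    ⟨{s(0, 9), s(1, 8), s(2, 6), s(3, 4), s(5, 7)}, by decide⟩, ⟨{s(0, 5), s(1, 4), s(2, 8), s(3, 7), s(6, 9)}, by decide⟩,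
    ⟨{s(0, 3), s(1, 7), s(2, 9), s(4, 5), s(6, 8)}, by decide⟩, ⟨{s(0, 8), s(1, 7), s(2, 9), s(3, 6), s(4, 5)}, by decide⟩,
    ⟨{s(0, 2), s(1, 7), s(3, 6), s(4, 5), s(8, 9)}, by decide⟩, ⟨{s(0, 2), s(1, 9), s(3, 8), s(4, 6), s(5, 7)}, by decide⟩,
    ⟨{s(0, 8), s(1, 5), s(2, 6), s(3, 9), s(4, 7)}, by decide⟩, ⟨{s(0, 6), s(1, 3), s(2, 8), s(4, 5), s(7, 9)}, by decide⟩,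
    ⟨{s(0, 6), s(1, 3), s(2, 8), s(4, 7), s(5, 9)}, by decide⟩, ⟨{s(0, 8), s(1, 5), s(2, 4), s(3, 6), s(7, 9)}, by decide⟩,
    ⟨{s(0, 9), s(1, 3), s(2, 5), s(4, 7), s(6, 8)}, by decide⟩]

/-- The `0/1` support pattern `X` of the minor. [cite: GouveiaRobinsonThomas2013, Ex. 2.3 (p05)] -/
def Xn : Fin 15 → Fin 15 → ℕ :=
  ![![1, 0, 1, 1, 1, 0, 1, 1, 1, 1, 1, 0, 1, 0, 1],
    ![1, 1, 1, 0, 1, 0, 1, 1, 1, 1, 0, 0, 1, 0, 1],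
    ![0, 1, 1, 1, 1, 1, 0, 1, 0, 0, 1, 1, 1, 1, 1],
    ![1, 1, 1, 1, 1, 0, 1, 1, 1, 1, 1, 1, 1, 1, 1],
    ![1, 1, 0, 0, 1, 1, 1, 1, 1, 1, 0, 1, 1, 0, 0],
    ![1, 1, 1, 1, 0, 1, 1, 1, 1, 1, 0, 1, 1, 1, 1],
    ![0, 1, 1, 1, 1, 1, 1, 1, 0, 0, 1, 1, 1, 1, 1],
    ![0, 0, 1, 1, 1, 1, 0, 0, 0, 0, 1, 0, 1, 0, 1],
    ![0, 1, 1, 1, 0, 1, 1, 1, 1, 0, 1, 1, 1, 1, 0],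
    ![1, 1, 0, 0, 1, 1, 1, 1, 0, 0, 1, 1, 1, 1, 1],
    ![1, 1, 1, 1, 1, 1, 0, 0, 0, 1, 1, 1, 1, 1, 1],
    ![0, 1, 1, 1, 1, 1, 0, 1, 1, 1, 1, 0, 0, 1, 0],
    ![0, 0, 1, 1, 1, 0, 1, 1, 1, 0, 1, 1, 1, 1, 1],
    ![1, 0, 0, 0, 1, 1, 1, 0, 0, 1, 1, 1, 1, 0, 1],
    ![1, 1, 1, 0, 1, 1, 1, 1, 0, 1, 1, 1, 1, 1, 1]]

/-- On the minor `cc = 2·X + 1`, i.e. `S = 2·X` (kernel `decide`). [cite: GouveiaRobinsonThomas2013, Ex. 2.3 (p05)] -/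
theorem cc_minor : ∀ a b : Fin 15, cc (toOdd (ρm a)) (γm b) = 2 * Xn a b + 1 := by decide

/-- `X` is a `0/1` matrix. [cite: GouveiaRobinsonThomas2013, Ex. 2.3 (p05)] -/
theorem Xn_le_one : ∀ a b : Fin 15, Xn a b ≤ 1 := by decide

/-- The support pattern over `𝔽₂`. [cite: GouveiaRobinsonThomas2013, Ex. 2.3 (p05)] -/
def X2 : Matrix (Fin 15) (Fin 15) (ZMod 2) := fun a b => (Xn a b : ZMod 2)

/-- An explicit inverse of `X` over `𝔽₂`. [cite: GouveiaRobinsonThomas2013, Ex. 2.3 (p05)] -/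
def Y2 : Matrix (Fin 15) (Fin 15) (ZMod 2) :=
  !![1, 0, 1, 1, 1, 0, 1, 1, 1, 0, 0, 1, 1, 0, 0;
     1, 0, 0, 0, 0, 0, 0, 1, 0, 0, 1, 0, 1, 0, 0;
     0, 0, 1, 0, 1, 0, 1, 0, 1, 1, 1, 1, 1, 0, 1;
     1, 0, 0, 1, 0, 0, 1, 1, 0, 0, 1, 0, 0, 0, 1;
     1, 1, 1, 0, 1, 0, 0, 0, 1, 0, 1, 0, 0, 1, 1;
     0, 0, 1, 0, 1, 1, 1, 0, 1, 0, 1, 0, 1, 1, 0;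
     0, 0, 1, 0, 0, 0, 1, 0, 0, 0, 0, 0, 0, 0, 0;
     1, 0, 1, 1, 0, 0, 0, 1, 0, 0, 0, 0, 0, 0, 0;
     1, 0, 1, 0, 1, 1, 0, 1, 1, 0, 0, 0, 1, 1, 0;
     0, 0, 1, 0, 1, 0, 1, 0, 1, 0, 1, 1, 1, 0, 0;
     1, 1, 0, 1, 0, 0, 1, 0, 0, 0, 0, 0, 1, 0, 1;
     0, 0, 0, 0, 1, 0, 1, 1, 1, 1, 1, 1, 1, 1, 0;
     1, 1, 1, 0, 1, 0, 1, 1, 0, 1, 1, 1, 0, 0, 1;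
     0, 0, 0, 1, 1, 0, 1, 0, 1, 1, 0, 1, 0, 1, 0;
     0, 1, 0, 0, 0, 1, 1, 1, 1, 0, 1, 0, 1, 0, 1]

/-- `X · Y = 1` over `𝔽₂` (kernel `decide`). [cite: GouveiaRobinsonThomas2013, Ex. 2.3 (p05)] -/
theorem X2_mul_Y2 : X2 * Y2 = 1 := by decide

/-- `det X ≠ 0` over `𝔽₂`. [cite: GouveiaRobinsonThomas2013, Ex. 2.3 (p05)] -/
theorem det_X2_ne_zero : X2.det ≠ 0 := by
  intro h
  have h1 : (X2 * Y2).det = 1 := by rw [X2_mul_Y2, det_one]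
  rw [det_mul, h, zero_mul] at h1
  exact zero_ne_one h1

/-- The integer SIGN MATRIX of a real matrix on the minor's support. [cite: GouveiaRobinsonThomas2013, Ex. 2.3 (p05)] -/
def signMat (N' : Matrix (Fin 15) (Fin 15) ℝ) : Matrix (Fin 15) (Fin 15) ℤ :=
  fun a b => if 0 ≤ N' a b then (Xn a b : ℤ) else -(Xn a b : ℤ)

/-- Modulo `2` the sign matrix is the support pattern `X`. [cite: GouveiaRobinsonThomas2013, Ex. 2.3 (p05)] -/
theorem signMat_map_zmod (N' : Matrix (Fin 15) (Fin 15) ℝ) : (signMat N').map (Int.cast : ℤ → ZMod 2) = X2 := by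
  ext a b
  simp only [map_apply, X2, signMat]
  rcases Nat.le_one_iff_eq_zero_or_eq_one.1 (Xn_le_one a b) with h0 | h1
  · simp [h0]
  · rw [h1]
    split_ifs <;> decide

/-- Hence the sign matrix has odd, in particular nonzero, determinant. [cite: GouveiaRobinsonThomas2013, Ex. 2.3 (p05)] -/
theorem det_signMat_ne_zero (N' : Matrix (Fin 15) (Fin 15) ℝ) : (signMat N').det ≠ 0 := by
  intro h0
  apply det_X2_ne_zero
  have hmap : (((signMat N').det : ℤ) : ZMod 2) = ((signMat N').map (Int.cast : ℤ → ZMod 2)).det := by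
    have := RingHom.map_det (Int.castRingHom (ZMod 2)) (signMat N')
    simpa [RingHom.mapMatrix_apply] using this
  rw [← signMat_map_zmod N', ← hmap, h0, Int.cast_zero]

/-- **Every Hadamard square root of the block has rank `≥ 15`** (`N = √2·Z` on the minor, `det Z` odd).
[cite: GouveiaRobinsonThomas2013, Ex. 2.3 (p05)] -/
theorem fifteen_le_rank_of_sq_eq_S35 (N : Matrix T35 (PMatch 10) ℝ) (hN : ∀ i j, N i j ^ 2 = S35 i j) : 15 ≤ N.rank := by
  set N' : Matrix (Fin 15) (Fin 15) ℝ := N.submatrix ρm γm with hN'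
  have hsq : ∀ a b, N' a b ^ 2 = 2 * (Xn a b : ℝ) := by
    intro a b
    rw [hN', submatrix_apply, hN, S35_apply, cc_minor]
    push_cast
    ring
  have hs : Real.sqrt 2 ^ 2 = 2 := Real.sq_sqrt (by norm_num)
  have hZ : ∀ a b, N' a b = Real.sqrt 2 * ((signMat N' a b : ℤ) : ℝ) := by
    intro a b
    have h2 := hsq a b
    rcases Nat.le_one_iff_eq_zero_or_eq_one.1 (Xn_le_one a b) with h0 | h1
    · have hz : N' a b = 0 := by
        rw [h0, Nat.cast_zero, mul_zero] at h2
        exact (pow_eq_zero_iff (n := 2) (by norm_num)).1 h2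
      simp [signMat, hz, h0]
    · rw [h1, Nat.cast_one, mul_one] at h2
      have hfac : (N' a b - Real.sqrt 2) * (N' a b + Real.sqrt 2) = 0 := by
        have : (N' a b - Real.sqrt 2) * (N' a b + Real.sqrt 2) = N' a b ^ 2 - Real.sqrt 2 ^ 2 := by ring
        rw [this, hs, h2]; ring
      rcases mul_eq_zero.1 hfac with hp | hm
      · have hval : N' a b = Real.sqrt 2 := by linarith
        have hnn : 0 ≤ N' a b := by rw [hval]; exact Real.sqrt_nonneg 2
        have hZ1 : signMat N' a b = 1 := by simp [signMat, hnn, h1]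
        rw [hZ1, hval]; push_cast; ring
      · have hval : N' a b = -Real.sqrt 2 := by linarith
        have hneg : ¬ 0 ≤ N' a b := by
          rw [hval, not_le, neg_lt_zero]; exact Real.sqrt_pos.2 (by norm_num)
        have hZm : signMat N' a b = -1 := by simp [signMat, hneg, h1]
        rw [hZm, hval]; push_cast; ring
  have hN'eq : N' = Real.sqrt 2 • ((signMat N').map (Int.cast : ℤ → ℝ)) := by
    ext a b
    rw [Matrix.smul_apply, map_apply, smul_eq_mul, hZ]
  have hdetN' : N'.det ≠ 0 := by
    rw [hN'eq, det_smul, Fintype.card_fin]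
    have hmap : ((signMat N').map (Int.cast : ℤ → ℝ)).det = (((signMat N').det : ℤ) : ℝ) := by
      have := RingHom.map_det (Int.castRingHom ℝ) (signMat N')
      simpa [RingHom.mapMatrix_apply] using this.symm
    rw [hmap]
    refine mul_ne_zero (pow_ne_zero _ (Real.sqrt_ne_zero'.2 (by norm_num))) ?_
    exact_mod_cast det_signMat_ne_zero N'
  have hrank : N'.rank = 15 := by
    simpa using rank_of_isUnit N' ((isUnit_iff_isUnit_det _).2 (isUnit_iff_ne_zero.2 hdetN'))
  calc 15 = N'.rank := hrank.symm
    _ ≤ N.rank := by rw [hN']; exact rank_submatrix_le N ρm γm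

/-! ### §6 The theorems -/

/-- **The `{3,5}`-block of `S_odd(K₁₀)` has no psd factorisation of size `14`.**
[cite: GouveiaRobinsonThomas2013, Prop. 2.6 + Lemma 2.4 + Ex. 2.3 (p05–p07)] -/
theorem not_hasPsdFactorization_S35_fourteen : ¬ HasPsdFactorization S35 14 := by
  intro h
  obtain ⟨N, hN, hr⟩ := hasHadamardSqrt_of_hasPsdFactorization_fourteen h
  have := fifteen_le_rank_of_sq_eq_S35 N hN
  omega

end PsdRankTenLower

open PsdRankTenLower

/-- **`rk_psd(S_odd(K₁₀)) ≥ 15`**: Edmonds' odd-cut slack matrix of `K₁₀` has NO psd factorisation of size `14` —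
one more than the largest triangular pattern (`14`, `PsdRankSmall.isSupportBasedPsdBound_ten`; exhaustively maximal).
[cite: GouveiaRobinsonThomas2013, Prop. 2.6 + Lemma 2.4 + Ex. 2.3 (p05–p07); FawziEtAl2015, Prop. 6.2 (p18)] -/
theorem not_hasPsdFactorization_pmOddCutSlack_ten_fourteen : ¬ HasPsdFactorization (pmOddCutSlack 10) 14 :=
  fun h => not_hasPsdFactorization_S35_fourteen (hasPsdFactorization_S35 h)

/-- `rk_psd(S_odd(K₁₀)) ≥ 15` in the `≤`-form. [cite: GouveiaRobinsonThomas2013, Prop. 2.6 + Lemma 2.4 + Ex. 2.3 (p05–p07)] -/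
theorem fifteen_le_of_hasPsdFactorization_ten {r : ℕ} (h : HasPsdFactorization (pmOddCutSlack 10) r) : 15 ≤ r := by
  by_contra hlt
  exact not_hasPsdFactorization_pmOddCutSlack_ten_fourteen (h.mono (by omega))

end Literature.Barriers.PneNP
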